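import Mathlib
import Summits.Ventures.HodgeRepro2.T5EpsilonTwist

/-!
# T5TameGaussSum — the Gauss-sum identity behind (T1) in the tamely ramified case, from Mathlib

T5EpsilonTwist.lean (p392515) derives (T1) `ε(s, ω, ψ) ε(1 − s, ω⁻¹, ψ) = ω(−1)` from Kudla's printed
shape of the ε-factor GIVEN the identity `𝔤(ω|_U) · 𝔤(ω⁻¹|_U) = ω(−1)` for the normalised Gauss sums
(route/T5-CHECK-G-p7.md §4 [R-4]: «the substitution y ↦ −y in the Gauss sum … |𝔤| = 1»).  When the
conductor exponent is 1 (tame ramification), Kudla's Gauss sum is the classical Gauss sum of the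
induced character of the residue field `k = O/𝔭` against a primitive additive character of `k`,
normalised by `q^{−1/2}`, and the identity is Mathlib's `gaussSum_mul_gaussSum_eq_card` together with
`mul_gaussSum_inv_eq_gaussSum`:

* `gaussSum_mul_gaussSum_inv` — `𝔤(χ, ψ) · 𝔤(χ⁻¹, ψ) = χ(−1) · #k` for `χ ≠ 1`, `ψ` primitive;
* `gNorm` — the normalised Gauss sum `q^{−1/2} · 𝔤(χ, ψ)` (as a complex number), and
  `gNorm_mul_gNorm_inv` — `gNorm χ ψ · gNorm χ⁻¹ ψ = χ(−1)`;
* `epsShape_mul_epsShape_inv_of_tame` — (T1) for an `epsShape` whose Gauss-sum function takes the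
  values `gNorm χ ψ` and `gNorm χ⁻¹ ψ` on `ω|_U` and `ω⁻¹|_U`, and with `ω(−1) = χ(−1)`.

Stays prose: that the restriction of a tamely ramified `ω` to the units factors through `k^×` as a
non-trivial character `χ` with `ω(−1) = χ(−1)`, and that Kudla's integral over `O^×` is this finite sum
(the normalisation of the Haar measure); wildly ramified conductors are not covered.
-/

namespace Summit.Ventures.HodgeRepro2.T5TameGaussSum

open Summit.Ventures.HodgeRepro2.T5EpsilonTwist

variable {k : Type*} [Field k] [Fintype k]

/-- `𝔤(χ, ψ) · 𝔤(χ⁻¹, ψ) = χ(−1) · #k` for a non-trivial `χ` and a primitive `ψ` (Mathlib's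
`gaussSum_mul_gaussSum_eq_card`, with `ψ⁻¹` traded for `ψ` by `mul_gaussSum_inv_eq_gaussSum`). -/
theorem gaussSum_mul_gaussSum_inv {χ : MulChar k ℂ} (hχ : χ ≠ 1) {ψ : AddChar k ℂ}
    (hψ : ψ.IsPrimitive) :
    gaussSum χ ψ * gaussSum χ⁻¹ ψ = χ (-1) * (Fintype.card k : ℂ) := by
  have h1 : χ⁻¹ (-1) * gaussSum χ⁻¹ ψ⁻¹ = gaussSum χ⁻¹ ψ := mul_gaussSum_inv_eq_gaussSum χ⁻¹ ψ
  have h2 : gaussSum χ ψ * gaussSum χ⁻¹ ψ⁻¹ = (Fintype.card k : ℂ) :=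
    gaussSum_mul_gaussSum_eq_card hχ hψ
  have h3 : χ⁻¹ (-1) = χ (-1) := by
    rw [MulChar.inv_apply', inv_neg, inv_one]
  calc gaussSum χ ψ * gaussSum χ⁻¹ ψ
      = χ⁻¹ (-1) * (gaussSum χ ψ * gaussSum χ⁻¹ ψ⁻¹) := by rw [← h1]; ring
    _ = χ (-1) * (Fintype.card k : ℂ) := by rw [h2, h3]

/-- The normalised Gauss sum `q^{−1/2} · 𝔤(χ, ψ)`, `q = #k`. -/
noncomputable def gNorm (χ : MulChar k ℂ) (ψ : AddChar k ℂ) : ℂ :=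
  ((Real.sqrt (Fintype.card k))⁻¹ : ℝ) * gaussSum χ ψ

/-- `gNorm χ ψ · gNorm χ⁻¹ ψ = χ(−1)`: the Gauss-sum identity of CHECK-G §4 in the tame case. -/
theorem gNorm_mul_gNorm_inv {χ : MulChar k ℂ} (hχ : χ ≠ 1) {ψ : AddChar k ℂ}
    (hψ : ψ.IsPrimitive) : gNorm χ ψ * gNorm χ⁻¹ ψ = χ (-1) := by
  have hq : (0 : ℝ) < Fintype.card k := by exact_mod_cast Fintype.card_pos
  have hsq : ((Real.sqrt (Fintype.card k))⁻¹ : ℝ) * ((Real.sqrt (Fintype.card k))⁻¹ : ℝ) =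
      ((Fintype.card k : ℝ))⁻¹ := by
    rw [← mul_inv, Real.mul_self_sqrt hq.le]
  have hqc : (Fintype.card k : ℂ) ≠ 0 := by exact_mod_cast Fintype.card_ne_zero
  unfold gNorm
  calc ((Real.sqrt (Fintype.card k))⁻¹ : ℝ) * gaussSum χ ψ *
        (((Real.sqrt (Fintype.card k))⁻¹ : ℝ) * gaussSum χ⁻¹ ψ)
      = ((((Real.sqrt (Fintype.card k))⁻¹ : ℝ) * ((Real.sqrt (Fintype.card k))⁻¹ : ℝ) : ℝ) : ℂ) *
          (gaussSum χ ψ * gaussSum χ⁻¹ ψ) := by push_cast; ring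
    _ = ((Fintype.card k : ℂ))⁻¹ * (χ (-1) * (Fintype.card k : ℂ)) := by
          rw [hsq, gaussSum_mul_gaussSum_inv hχ hψ]; push_cast; ring
    _ = χ (-1) := by field_simp

/-- (T1) in the tame case: if the Gauss-sum function of the shape takes the values `gNorm χ ψ` on
`ω|_U` and `gNorm χ⁻¹ ψ` on `ω⁻¹|_U` (the restriction of `ω` to the units factoring through the
residue field as `χ`), `ω(−1) = χ(−1)` and the conductors agree, then
`ε(s, ω, ψ) · ε(1 − s, ω⁻¹, ψ) = ω(−1)`. -/
theorem epsShape_mul_epsShape_inv_of_tame {Kx : Type*} [CommGroup Kx] (U : Subgroup Kx) (ϖ : Kx)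
    {q : ℂ} (hq : q ≠ 0) (n : ℤ) (c : (Kx →* ℂˣ) → ℕ) (G : (U →* ℂˣ) → ℂ) (s : ℂ)
    (ω : Kx →* ℂˣ) (m1 : Kx) (hc : c ω⁻¹ = c ω)
    {χ : MulChar k ℂ} (hχ : χ ≠ 1) {ψ : AddChar k ℂ} (hψ : ψ.IsPrimitive)
    (hG₁ : G (ω.restrict U) = gNorm χ ψ) (hG₂ : G (ω⁻¹.restrict U) = gNorm χ⁻¹ ψ)
    (hm1 : ((ω m1 : ℂˣ) : ℂ) = χ (-1)) :
    epsShape U ϖ q n c G s ω * epsShape U ϖ q n c G (1 - s) ω⁻¹ = ((ω m1 : ℂˣ) : ℂ) := by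
  apply epsShape_mul_epsShape_inv U ϖ hq n c G s ω m1 hc
  rw [hG₁, hG₂, gNorm_mul_gNorm_inv hχ hψ, hm1]

end Summit.Ventures.HodgeRepro2.T5TameGaussSum
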